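import Literature.NumberTheory.Transcendental.QuadraticRelationsLogarithmsWeilHeight

/-!
# Nesterenko–Waldschmidt 1996, Theorem 1 (Main Theorem): a simultaneous approximation measure for `θ` and `e^θ`

Yu. V. Nesterenko, M. Waldschmidt, *On the approximation of the values of exponential function and
logarithm by algebraic numbers*, Mat. Zapiski 2 (1996) 23–42 (= arXiv:math/0002047), Theorem 1
(Main Theorem), p. 1 of the arXiv version. NAMED FACT (statement only, not proved here); users take
`(h : NesterenkoWaldschmidt1996_thm_1)`.

The absolute logarithmic Weil height `h(x)` is the tree's `weilHeight₁` computed in `K = ℚ(α, β)`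
(field-independent: `weilHeight₁_root_eq`, `QuadraticRelationsLogarithmsMahlerWeil.lean`);
`D = [ℚ(α, β) : ℚ]`; `|θ|₊ = max(1, |θ|)`.  The text below is, VERBATIM, the hypothesis `hmain` of
the tree's `NesterenkoWaldschmidt1996.part1_of_mainThm` (`PiAlgebraicApproximationMeasure.lean`,
which derives Theorem 2(1) from it) — with that file's harmless extra guards `α ≠ 0`, `β ≠ 0`
(the paper assumes only `θ ≠ 0`): ONE registered fact then serves both consumers.

Consumer: the decomp-schanuel cell's route `RootDecomp1K` (lens-6 «DarkCarving», gen 10: the weak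
transcendence measure at the exponential-algebraic points `Q(t, e^t) = 0` and at the logarithms of
algebraic numbers and at `e^β`, `β ∈ ℚ̄*` — `darkWeakMeasure_of_NW1996Thm1`,
`weakMeasure_log_of_NW1996Thm1`, `weakMeasure_exp_of_NW1996Thm1` — whence `HyperLiouvilleSchanuel`
(stmt-Schanuel-33363) at every level `n ≤ 2` modulo this fact alone).
-/

namespace Literature.NumberTheory.Transcendental

/-- **Nesterenko–Waldschmidt 1996, Theorem 1 (Main Theorem)** (Mat. Zapiski 2 (1996) 23–42 =
arXiv:math/0002047, p. 1): "Let `θ ∈ ℂ`, `θ ≠ 0`, and `α, β` be algebraic numbers; define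
`K = ℚ(α, β)` and `D = [K : ℚ]`. Let `A`, `B` and `E` be positive real numbers with `E ≥ e` satisfying
`log A ≥ max(h(α), D⁻¹)`, `log B ≥ h(β)`. Then
`|e^θ − α| + |θ − β| ≥ exp(−211 D (log B + log log A + 4 log D + 2 log(E|θ|₊) + 10) ·
(D log A + 2E|θ| + 6 log E) · (3.3 D log(D+2) + log E) · (log E)⁻²)`, where `|θ|₊ = max(1, |θ|)`."
Here `h` = `weilHeight₁` computed in `K`, `|·|` = the complex modulus; stated with the extra
hypotheses `α ≠ 0`, `β ≠ 0` (a weakening; verbatim the hypothesis `hmain` of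
`NesterenkoWaldschmidt1996.part1_of_mainThm`). NAMED FACT, not proved here; users take
`(h : NesterenkoWaldschmidt1996_thm_1)`.
[cite: NesterenkoWaldschmidt1996, Theorem 1] [file NumberTheory/Transcendental/ExpLogSimultaneousApproximationMeasure] -/
def NesterenkoWaldschmidt1996_thm_1 : Prop :=
  ∀ (θ α β : ℂ) (A B E : ℝ), θ ≠ 0 → α ≠ 0 → β ≠ 0 → IsAlgebraic ℚ α → IsAlgebraic ℚ β →
      0 < A → 0 < B → Real.exp 1 ≤ E →
      max (weilHeight₁ (IntermediateField.adjoin ℚ ({α, β} : Set ℂ)) (fun _ : Unit => α))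
          (1 / (Module.finrank ℚ (IntermediateField.adjoin ℚ ({α, β} : Set ℂ)) : ℝ)) ≤ Real.log A →
      weilHeight₁ (IntermediateField.adjoin ℚ ({α, β} : Set ℂ)) (fun _ : Unit => β) ≤ Real.log B →
      Real.exp (-(211 * (Module.finrank ℚ (IntermediateField.adjoin ℚ ({α, β} : Set ℂ)) : ℝ) *
          (Real.log B + Real.log (Real.log A) +
            4 * Real.log (Module.finrank ℚ (IntermediateField.adjoin ℚ ({α, β} : Set ℂ)) : ℝ) +
            2 * Real.log (E * max 1 ‖θ‖) + 10) *
          ((Module.finrank ℚ (IntermediateField.adjoin ℚ ({α, β} : Set ℂ)) : ℝ) * Real.log A +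
            2 * E * ‖θ‖ + 6 * Real.log E) *
          ((33 / 10 : ℝ) * (Module.finrank ℚ (IntermediateField.adjoin ℚ ({α, β} : Set ℂ)) : ℝ) *
              Real.log ((Module.finrank ℚ (IntermediateField.adjoin ℚ ({α, β} : Set ℂ)) : ℝ) + 2) +
            Real.log E) /
          Real.log E ^ 2)) ≤
        ‖Complex.exp θ - α‖ + ‖θ - β‖

/-- **Nesterenko–Waldschmidt 1996, Theorem 1 with the numerical constant as a parameter.**
`NW1996MainR c` is, VERBATIM, the text of `NesterenkoWaldschmidt1996_thm_1` above with the numeral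
`211` replaced by the real parameter `c`; `NW1996MainR 211` is the registered fact definitionally
(by `Iff.rfl`).  Purpose (decomp-schanuel lens-6 g22
audit, critic RULING/VERDICT on the cell bus 2026-08-31): the PRINTED proof of Theorem 1 (arXiv version
§6) does not establish the constant `211` as written — Lemma 6 is printed with the row-label box
`0 ≤ s_μ ≤ S₁`, which is too small to carry `L = (T+1)(2T₁+1)` distinct labels, while its proof gives
`|s_μ| ≤ S₁`, for which the degree bound of step c) doubles and the closing budget of step d) fails;
the STATEMENT with `211` is unrefuted.  Consumers that only need *some* constant may bind the weaker
`NW1996MainR c` for a larger `c` (the audited repair scheme `S = [25UV]`, `S₁ = [9DW + ½]`,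
`T = [33DVW]`, `T₁ = [5U + ½]`, `H = [1.1 W log E]` closes with `c = 400`), a statement implied by the
registered fact since the bound is antitone in `c`.  This is a parametrised statement, not an additional
named fact: nothing is asserted to hold here.
[cite: NesterenkoWaldschmidt1996, Theorem 1] -/
def NW1996MainR (c : ℝ) : Prop :=
  ∀ (θ α β : ℂ) (A B E : ℝ), θ ≠ 0 → α ≠ 0 → β ≠ 0 → IsAlgebraic ℚ α → IsAlgebraic ℚ β →
      0 < A → 0 < B → Real.exp 1 ≤ E →
      max (weilHeight₁ (IntermediateField.adjoin ℚ ({α, β} : Set ℂ)) (fun _ : Unit => α))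
          (1 / (Module.finrank ℚ (IntermediateField.adjoin ℚ ({α, β} : Set ℂ)) : ℝ)) ≤ Real.log A →
      weilHeight₁ (IntermediateField.adjoin ℚ ({α, β} : Set ℂ)) (fun _ : Unit => β) ≤ Real.log B →
      Real.exp (-(c * (Module.finrank ℚ (IntermediateField.adjoin ℚ ({α, β} : Set ℂ)) : ℝ) *
          (Real.log B + Real.log (Real.log A) +
            4 * Real.log (Module.finrank ℚ (IntermediateField.adjoin ℚ ({α, β} : Set ℂ)) : ℝ) +
            2 * Real.log (E * max 1 ‖θ‖) + 10) *
          ((Module.finrank ℚ (IntermediateField.adjoin ℚ ({α, β} : Set ℂ)) : ℝ) * Real.log A +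
            2 * E * ‖θ‖ + 6 * Real.log E) *
          ((33 / 10 : ℝ) * (Module.finrank ℚ (IntermediateField.adjoin ℚ ({α, β} : Set ℂ)) : ℝ) *
              Real.log ((Module.finrank ℚ (IntermediateField.adjoin ℚ ({α, β} : Set ℂ)) : ℝ) + 2) +
            Real.log E) /
          Real.log E ^ 2)) ≤
        ‖Complex.exp θ - α‖ + ‖θ - β‖

/-- **Nesterenko–Waldschmidt 1996, Theorem 1 restricted to NON-REAL `ℚ(α, β)`** (i.e. `α ∉ ℝ` or `β ∉ ℝ`),
with the numerical constant as a parameter `c`: VERBATIM the text of `NesterenkoWaldschmidt1996_thm_1` above with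
`211` replaced by `c` and ONE extra hypothesis `α.im ≠ 0 ∨ β.im ≠ 0`.  Purpose (decomp-schanuel lens-6 g22 audit,
addendum; critic booking on the cell bus 2026-08-31): for non-real `ℚ(α, β)` Liouville's inequality in the printed
proof has `D' = D/2` and the printed §6 budget of the paper closes with `c = 211` — `NW1996MainNonreal 211` is the
part of Theorem 1 that the printed argument establishes outright (the audited gap concerns the REAL case with
`h(α) > ½ log A` only).  A parametrised TARGET TEXT: nothing is asserted to hold here; `NW1996MainR c` implies it
trivially.
[cite: NesterenkoWaldschmidt1996, Theorem 1] -/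
def NW1996MainNonreal (c : ℝ) : Prop :=
  ∀ (θ α β : ℂ) (A B E : ℝ), θ ≠ 0 → α ≠ 0 → β ≠ 0 → IsAlgebraic ℚ α → IsAlgebraic ℚ β →
      (α.im ≠ 0 ∨ β.im ≠ 0) →
      0 < A → 0 < B → Real.exp 1 ≤ E →
      max (weilHeight₁ (IntermediateField.adjoin ℚ ({α, β} : Set ℂ)) (fun _ : Unit => α))
          (1 / (Module.finrank ℚ (IntermediateField.adjoin ℚ ({α, β} : Set ℂ)) : ℝ)) ≤ Real.log A →
      weilHeight₁ (IntermediateField.adjoin ℚ ({α, β} : Set ℂ)) (fun _ : Unit => β) ≤ Real.log B →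
      Real.exp (-(c * (Module.finrank ℚ (IntermediateField.adjoin ℚ ({α, β} : Set ℂ)) : ℝ) *
          (Real.log B + Real.log (Real.log A) +
            4 * Real.log (Module.finrank ℚ (IntermediateField.adjoin ℚ ({α, β} : Set ℂ)) : ℝ) +
            2 * Real.log (E * max 1 ‖θ‖) + 10) *
          ((Module.finrank ℚ (IntermediateField.adjoin ℚ ({α, β} : Set ℂ)) : ℝ) * Real.log A +
            2 * E * ‖θ‖ + 6 * Real.log E) *
          ((33 / 10 : ℝ) * (Module.finrank ℚ (IntermediateField.adjoin ℚ ({α, β} : Set ℂ)) : ℝ) *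
              Real.log ((Module.finrank ℚ (IntermediateField.adjoin ℚ ({α, β} : Set ℂ)) : ℝ) + 2) +
            Real.log E) /
          Real.log E ^ 2)) ≤
        ‖Complex.exp θ - α‖ + ‖θ - β‖

/-- **Nesterenko–Waldschmidt 1996, Theorem 1 with the height hypothesis `max (κ·h(α)) (1/D) ≤ log A`** and
the numerical constant as a parameter `c`: VERBATIM the text of `NesterenkoWaldschmidt1996_thm_1` above with `211`
replaced by `c` and `h(α)` replaced by `κ·h(α)` in the hypothesis on `A`.  `κ = 1` is the registered shape
(`NW1996MainRH 1 c ↔ NW1996MainR c` up to `1 * h = h`); `κ = 2` (`h(α) ≤ ½ log A`) is the regime in which the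
printed §6 budget closes for ALL fields with `c = 211` (decomp-schanuel lens-6 g22 audit, addendum), and the
audited transfer `A ↦ A²` gives `NW1996MainRH 2 c → NW1996MainR ((127/60)·c)` (proved Summit-side).  A
parametrised TARGET TEXT: nothing is asserted to hold here.
[cite: NesterenkoWaldschmidt1996, Theorem 1] -/
def NW1996MainRH (κ c : ℝ) : Prop :=
  ∀ (θ α β : ℂ) (A B E : ℝ), θ ≠ 0 → α ≠ 0 → β ≠ 0 → IsAlgebraic ℚ α → IsAlgebraic ℚ β →
      0 < A → 0 < B → Real.exp 1 ≤ E →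
      max (κ * weilHeight₁ (IntermediateField.adjoin ℚ ({α, β} : Set ℂ)) (fun _ : Unit => α))
          (1 / (Module.finrank ℚ (IntermediateField.adjoin ℚ ({α, β} : Set ℂ)) : ℝ)) ≤ Real.log A →
      weilHeight₁ (IntermediateField.adjoin ℚ ({α, β} : Set ℂ)) (fun _ : Unit => β) ≤ Real.log B →
      Real.exp (-(c * (Module.finrank ℚ (IntermediateField.adjoin ℚ ({α, β} : Set ℂ)) : ℝ) *
          (Real.log B + Real.log (Real.log A) +
            4 * Real.log (Module.finrank ℚ (IntermediateField.adjoin ℚ ({α, β} : Set ℂ)) : ℝ) +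
            2 * Real.log (E * max 1 ‖θ‖) + 10) *
          ((Module.finrank ℚ (IntermediateField.adjoin ℚ ({α, β} : Set ℂ)) : ℝ) * Real.log A +
            2 * E * ‖θ‖ + 6 * Real.log E) *
          ((33 / 10 : ℝ) * (Module.finrank ℚ (IntermediateField.adjoin ℚ ({α, β} : Set ℂ)) : ℝ) *
              Real.log ((Module.finrank ℚ (IntermediateField.adjoin ℚ ({α, β} : Set ℂ)) : ℝ) + 2) +
            Real.log E) /
          Real.log E ^ 2)) ≤
        ‖Complex.exp θ - α‖ + ‖θ - β‖

end Literature.NumberTheory.Transcendental
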